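import Mathlib
import HarnessLib
import Summits.HubbardSuperconductivity.HubbardSuperconductivity.Theorems.KLProgrammeKLRegimeCountertermPolarAngleRay
import Summits.HubbardSuperconductivity.HubbardSuperconductivity.Theorems.KLProgrammeKLRegimeCountertermNodeIdentity
import Summits.HubbardSuperconductivity.HubbardSuperconductivity.Theorems.KLProgrammeKLRegimeCountertermPieceLipschitz
import Summits.HubbardSuperconductivity.HubbardSuperconductivity.Theorems.KLProgrammeKLRegimeSplitTwoLegAngular

/-!
# Route `KLProgramme` — child `KLRegimeCounterterm` (gen 3, stmt-HubbardSuperconductivity-19825): RAY FLATNESS OF THE G-PIECES INSIDE THE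
# FLAT TUBE — input (I2) of k3c3-p2's wholesale continuation (cell gate-hubbard-kl STATUS 2026-08-26T19:23:20Z / 19:35:00Z), seat p1b (g5)

A polynomial `P : TrigPolyC4v` that READS a `2π`-periodic `Λ_g`-Lipschitz angular profile `g` on the flat-tube grid,
`P(p_k) = g(θ_k)` at every lattice momentum `p_k` with `|ε(p_k) − μ| ≤ klFlatR` (`θ_k = momentumAngle L k`), and is `Λ_P`-Lipschitz in the
`ℓ¹` metric of momenta, reads `g` everywhere on the HALF flat tube `{|ε − μ| ≤ klFlatR/2}` up to the OFF-LATTICE WIGGLE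
`W = Λ_P·(2π/L) + Λ_g·π·(2π/L)/r` (`r ≤ ‖q‖`, seam margin `|qᵢ| ≤ π − 2π/L`, `8π/klFlatR ≤ L`):

* §1 generic: `abs_eval_sub_profile_polarAngle_le_of_gridRead` (`|P(q) − g(polarAngle q)| ≤ W`), on a ray
  `abs_eval_smul_dir_sub_profile_le_of_gridRead` (`|P(t·dir θ) − g θ| ≤ W`), and **RAY FLATNESS**
  `abs_eval_smul_dir_sub_eval_smul_dir_le_of_gridRead` (`|P(t·dir θ) − P(t′·dir θ)| ≤ 2W` for two half-flat-tube points of one ray) —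
  the chain of p1b g4's `abs_eval_klFrameExtG_sub_le` (nearest flat-tube site `exists_site_near_levelPoint_flatTube`, periodicity
  `eval_torusCentredMomentum`, chord–arc `abs_sub_polarAngle_le_of_sup`) with the grid reading abstracted into a hypothesis, hence valid
  for EVERY `μ` (no `μ ≤ −1/10`);
* §2 the G-objects, EVERY frame `K : TrigPolyC4v`, every `μ` (grid readings = k3c3-p3's `…CountertermGridIdentity` / `…NodeIdentity`,
  periodicity of the profiles = `klLocalPart_periodic` / `frameOnCurve_periodic`): the pieces `ℓ_{n+1}^G(K)` (profile `ν_{n+1}(K) − ν_n(K)`),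
  `ℓ_0^G(K)` (profile `ν_0(K) − K∘k_F`), and `D_n^G(K)` (profile `ν_n(K)`) — wiggle on a ray and ray flatness, with the Lipschitz constants
  of the profiles (`Λ_ν`, from (E3g) `TwoLegAngularG.abs_sub_le`; `Λ_F` of `K∘k_F`, from k3c3-p3's `abs_frameOnCurve_sub_le`) and of the
  polynomial (`Λ_P`, from (E3a-G) `j = 1` via k3c3-p3's `abs_eval_sub_eval_le_of_norm_iteratedFDeriv_one_le`) as hypotheses;
* §3 the slot instance: under (E3a-G) `TwoLegSizesG … (n+1)` and (E3g) `TwoLegAngularG … (n+1)`, `TwoLegAngularG … n`,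
  `|ℓ_{n+1}^G(K)(t·dir θ) − ℓ_{n+1}^G(K)(t′·dir θ)| ≤ 2·(twoLegBar G Q U 1 (n+1)·(2π/L) + (angBar…1 + angBar…1)·π·(2π/L)/r)` —
  k3c3-p2's `rayBar`, volume-uniform constants times `1/L`.

Proofs only; nothing is asserted about the Hubbard model.
-/

noncomputable section

namespace Summit.HubbardSuperconductivity.HubbardSuperconductivity.Theorems.KLRegimeSplit

set_option linter.dupNamespace false -- summit = problem name (single-conjunct summit), D-0017

open Real Literature.MathematicalPhysics.QuantumLattice Literature.Probability.LatticeModels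
open Literature.MathematicalPhysics.QuantumLattice.BandSectorCounting
open Summit.HubbardSuperconductivity.HubbardSuperconductivity.Theorems.KLProgrammeLegKernels

variable (L : ℕ) [NeZero L]

/-! ## §1 Generic: a polynomial reading a periodic Lipschitz profile on the flat-tube grid -/

/-- **OFF-LATTICE WIGGLE from a grid reading.**  `P` reads the `2π`-periodic `Λ_g`-Lipschitz profile `g` at the flat-tube lattice momenta
and is `Λ_P`-Lipschitz (`ℓ¹` metric); then at every point `q` of the half flat tube (`ε(q) = μ + κ`, `|κ| ≤ klFlatR/2`) with seam margin
`|qᵢ| ≤ π − 2π/L`, `8π/klFlatR ≤ L`, `2π/L < r ≤ ‖q‖`:  `|P(q) − g(polarAngle q)| ≤ Λ_P·(2π/L) + Λ_g·π·(2π/L)/r`. -/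
theorem abs_eval_sub_profile_polarAngle_le_of_gridRead (P : TrigPolyC4v) {g : ℝ → ℝ} (hper : Function.Periodic g (2 * π))
    {Λg : ℝ} (hΛg : 0 ≤ Λg) (hLipg : ∀ a b, |g a - g b| ≤ Λg * |a - b|) {ΛP : ℝ} (hΛP : 0 ≤ ΛP)
    (hLipP : ∀ p p' : Fin 2 → ℝ, |P.eval p - P.eval p'| ≤ ΛP * (|p 0 - p' 0| + |p 1 - p' 1|)) {μ : ℝ}
    (hgrid : ∀ k : TorusSite 2 L, |nambuXi L μ k| ≤ klFlatR → P.eval (latticeMomentum L k) = g (momentumAngle L k))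
    {q : Fin 2 → ℝ} (hq : ∀ i, |q i| ≤ π - 2 * π / L) {κ : ℝ} (hε : eps2 (q 0) (q 1) = μ + κ) (hκ : |κ| ≤ klFlatR / 2)
    (hL : 8 * π / klFlatR ≤ L) {r : ℝ} (hr : 2 * π / L < r) (hrq : r ≤ ‖momToComplex q‖) :
    |P.eval q - g (polarAngle q)| ≤ ΛP * (2 * π / L) + Λg * π * (2 * (π / L) / r) := by
  have hLpos : (0 : ℝ) < L := Nat.cast_pos.2 (Nat.pos_of_ne_zero (NeZero.ne L))
  have hπL : 0 < 2 * π / L := by positivity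
  have hr0 : 0 < r := hπL.trans hr
  -- the nearest flat-tube site
  obtain ⟨k, hk, hξ⟩ := exists_site_near_levelPoint_flatTube L hq hε hκ hL
  -- (a) P(q) ≈ P(centred k)
  have ha : |P.eval q - P.eval (torusCentredMomentum L k)| ≤ ΛP * (2 * π / L) := by
    refine (hLipP q (torusCentredMomentum L k)).trans ?_
    have h0 := hk 0; have h1 := hk 1
    rw [abs_sub_comm] at h0 h1
    calc ΛP * (|q 0 - torusCentredMomentum L k 0| + |q 1 - torusCentredMomentum L k 1|) ≤ ΛP * (π / L + π / L) :=
          mul_le_mul_of_nonneg_left (add_le_add h0 h1) hΛP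
      _ = ΛP * (2 * π / L) := by ring
  -- (b) P(centred k) = P(p_k) = g(θ(k))
  have hb : P.eval (torusCentredMomentum L k) = g (momentumAngle L k) := by
    rw [eval_torusCentredMomentum]
    exact hgrid k hξ
  -- (c) g(θ(k)) ≈ g(θ(q))
  have hq0 : q ≠ 0 := by
    intro h0
    have : ‖momToComplex q‖ = 0 := by rw [h0]; simp [momToComplex]
    linarith
  have hc0 : torusCentredMomentum L k ≠ 0 := by
    intro h0
    have hd : ‖momToComplex q - momToComplex (torusCentredMomentum L k)‖ ≤ |q 0 - torusCentredMomentum L k 0| +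
        |q 1 - torusCentredMomentum L k 1| := norm_momToComplex_sub_le _ _
    have h0' : momToComplex (torusCentredMomentum L k) = 0 := by rw [h0]; simp [momToComplex]
    rw [h0', sub_zero] at hd
    have h0'' := hk 0; have h1'' := hk 1
    rw [abs_sub_comm] at h0'' h1''
    have e2 : π / (L : ℝ) + π / L = 2 * π / L := by ring
    have : ‖momToComplex q‖ ≤ 2 * π / L := by linarith
    linarith
  have hc : |g (momentumAngle L k) - g (polarAngle q)| ≤ Λg * π * (2 * (π / L) / r) := by
    rw [abs_sub_comm, momentumAngle_eq_polarAngle]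
    refine abs_sub_polarAngle_le_of_sup hper hΛg hLipg hq0 hc0 hr0 hrq fun i => ?_
    have := hk i
    rw [abs_sub_comm] at this
    exact this
  -- assemble
  calc |P.eval q - g (polarAngle q)|
      = |(P.eval q - P.eval (torusCentredMomentum L k)) + (g (momentumAngle L k) - g (polarAngle q))| := by rw [← hb]; ring_nf
    _ ≤ |P.eval q - P.eval (torusCentredMomentum L k)| + |g (momentumAngle L k) - g (polarAngle q)| := abs_add_le _ _
    _ ≤ ΛP * (2 * π / L) + Λg * π * (2 * (π / L) / r) := add_le_add ha hc

/-- **The wiggle ON A RAY.**  Under the hypotheses of `abs_eval_sub_profile_polarAngle_le_of_gridRead`, at a ray point `q = t·dir θ` of the half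
flat tube with `2π/L < r ≤ t`:  `|P(t·dir θ) − g θ| ≤ Λ_P·(2π/L) + Λ_g·π·(2π/L)/r`. -/
theorem abs_eval_smul_dir_sub_profile_le_of_gridRead (P : TrigPolyC4v) {g : ℝ → ℝ} (hper : Function.Periodic g (2 * π))
    {Λg : ℝ} (hΛg : 0 ≤ Λg) (hLipg : ∀ a b, |g a - g b| ≤ Λg * |a - b|) {ΛP : ℝ} (hΛP : 0 ≤ ΛP)
    (hLipP : ∀ p p' : Fin 2 → ℝ, |P.eval p - P.eval p'| ≤ ΛP * (|p 0 - p' 0| + |p 1 - p' 1|)) {μ : ℝ}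
    (hgrid : ∀ k : TorusSite 2 L, |nambuXi L μ k| ≤ klFlatR → P.eval (latticeMomentum L k) = g (momentumAngle L k))
    {t θ : ℝ} (hq : ∀ i, |(t • dir θ) i| ≤ π - 2 * π / L) {κ : ℝ} (hε : eps2 ((t • dir θ) 0) ((t • dir θ) 1) = μ + κ)
    (hκ : |κ| ≤ klFlatR / 2) (hL : 8 * π / klFlatR ≤ L) {r : ℝ} (hr : 2 * π / L < r) (hrt : r ≤ t) :
    |P.eval (t • dir θ) - g θ| ≤ ΛP * (2 * π / L) + Λg * π * (2 * (π / L) / r) := by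
  have hLpos : (0 : ℝ) < L := Nat.cast_pos.2 (Nat.pos_of_ne_zero (NeZero.ne L))
  have ht : 0 < t := lt_of_lt_of_le (lt_trans (by positivity) hr) hrt
  have hrq : r ≤ ‖momToComplex (t • dir θ)‖ := by rw [norm_momToComplex_smul_dir ht.le]; exact hrt
  have h := abs_eval_sub_profile_polarAngle_le_of_gridRead L P hper hΛg hLipg hΛP hLipP hgrid hq hε hκ hL hr hrq
  rwa [apply_polarAngle_smul_dir hper ht] at h

/-- **RAY FLATNESS from a grid reading.**  Under the hypotheses of `abs_eval_sub_profile_polarAngle_le_of_gridRead`, for TWO ray points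
`t·dir θ`, `t′·dir θ` of the half flat tube (each with its seam margin and `2π/L < r ≤ t, t′`):
`|P(t·dir θ) − P(t′·dir θ)| ≤ 2·(Λ_P·(2π/L) + Λ_g·π·(2π/L)/r)`. -/
theorem abs_eval_smul_dir_sub_eval_smul_dir_le_of_gridRead (P : TrigPolyC4v) {g : ℝ → ℝ}
    (hper : Function.Periodic g (2 * π)) {Λg : ℝ} (hΛg : 0 ≤ Λg) (hLipg : ∀ a b, |g a - g b| ≤ Λg * |a - b|) {ΛP : ℝ}
    (hΛP : 0 ≤ ΛP) (hLipP : ∀ p p' : Fin 2 → ℝ, |P.eval p - P.eval p'| ≤ ΛP * (|p 0 - p' 0| + |p 1 - p' 1|)) {μ : ℝ}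
    (hgrid : ∀ k : TorusSite 2 L, |nambuXi L μ k| ≤ klFlatR → P.eval (latticeMomentum L k) = g (momentumAngle L k))
    {t t' θ : ℝ} (hq : ∀ i, |(t • dir θ) i| ≤ π - 2 * π / L) (hq' : ∀ i, |(t' • dir θ) i| ≤ π - 2 * π / L) {κ κ' : ℝ}
    (hε : eps2 ((t • dir θ) 0) ((t • dir θ) 1) = μ + κ) (hκ : |κ| ≤ klFlatR / 2)
    (hε' : eps2 ((t' • dir θ) 0) ((t' • dir θ) 1) = μ + κ') (hκ' : |κ'| ≤ klFlatR / 2) (hL : 8 * π / klFlatR ≤ L) {r : ℝ}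
    (hr : 2 * π / L < r) (hrt : r ≤ t) (hrt' : r ≤ t') :
    |P.eval (t • dir θ) - P.eval (t' • dir θ)| ≤ 2 * (ΛP * (2 * π / L) + Λg * π * (2 * (π / L) / r)) := by
  have h1 := abs_eval_smul_dir_sub_profile_le_of_gridRead L P hper hΛg hLipg hΛP hLipP hgrid hq hε hκ hL hr hrt
  have h2 := abs_eval_smul_dir_sub_profile_le_of_gridRead L P hper hΛg hLipg hΛP hLipP hgrid hq' hε' hκ' hL hr hrt'
  rw [abs_sub_comm] at h2
  calc |P.eval (t • dir θ) - P.eval (t' • dir θ)|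
      = |(P.eval (t • dir θ) - g θ) + (g θ - P.eval (t' • dir θ))| := by ring_nf
    _ ≤ |P.eval (t • dir θ) - g θ| + |g θ - P.eval (t' • dir θ)| := abs_add_le _ _
    _ ≤ 2 * (ΛP * (2 * π / L) + Λg * π * (2 * (π / L) / r)) := by linarith

/-- The difference of two Lipschitz profiles is Lipschitz with the sum of the constants (bookkeeping). -/
theorem abs_sub_sub_sub_le_of_lipschitz {f g : ℝ → ℝ} {Λf Λg : ℝ} (hf : ∀ a b, |f a - f b| ≤ Λf * |a - b|)
    (hg : ∀ a b, |g a - g b| ≤ Λg * |a - b|) (a b : ℝ) :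
    |(f a - g a) - (f b - g b)| ≤ (Λf + Λg) * |a - b| := by
  calc |(f a - g a) - (f b - g b)| = |(f a - f b) - (g a - g b)| := by ring_nf
    _ ≤ |f a - f b| + |g a - g b| := abs_sub _ _
    _ ≤ Λf * |a - b| + Λg * |a - b| := add_le_add (hf a b) (hg a b)
    _ = (Λf + Λg) * |a - b| := by ring

/-! ## §2 The G-objects of a frame: the pieces `ℓ_n^G(K)` and the extended local part `D_n^G(K)` (every `K`, every `μ`) -/

section Model

variable (M : ℕ) [NeZero M]

/-- **Wiggle of the piece `ℓ_{n+1}^G(K)` on a ray**: with `ν_{n+1}(K)`, `ν_n(K)` Lipschitz in the angle (constants `Λ₁`, `Λ₀`) and the piece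
`Λ_P`-Lipschitz, at a ray point `t·dir θ` of the half flat tube:  `|ℓ_{n+1}^G(K)(t·dir θ) − (ν_{n+1}(K)(θ) − ν_n(K)(θ))| ≤ Λ_P·(2π/L) +
(Λ₁ + Λ₀)·π·(2π/L)/r`. -/
theorem abs_eval_klTwoLegPieceG_succ_smul_dir_sub_le {β U μ : ℝ} {K : TrigPolyC4v} {n : ℕ} {Λ₁ Λ₀ : ℝ} (hΛ₁ : 0 ≤ Λ₁)
    (hΛ₀ : 0 ≤ Λ₀) (hLip₁ : ∀ a b, |klLocalPart L M β U μ K (n + 1) a - klLocalPart L M β U μ K (n + 1) b| ≤ Λ₁ * |a - b|)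
    (hLip₀ : ∀ a b, |klLocalPart L M β U μ K n a - klLocalPart L M β U μ K n b| ≤ Λ₀ * |a - b|) {ΛP : ℝ} (hΛP : 0 ≤ ΛP)
    (hLipP : ∀ p p' : Fin 2 → ℝ, |(klTwoLegPieceG L M β U μ K (n + 1)).eval p - (klTwoLegPieceG L M β U μ K (n + 1)).eval p'| ≤
      ΛP * (|p 0 - p' 0| + |p 1 - p' 1|))
    {t θ : ℝ} (hq : ∀ i, |(t • dir θ) i| ≤ π - 2 * π / L) {κ : ℝ} (hε : eps2 ((t • dir θ) 0) ((t • dir θ) 1) = μ + κ)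
    (hκ : |κ| ≤ klFlatR / 2) (hL : 8 * π / klFlatR ≤ L) {r : ℝ} (hr : 2 * π / L < r) (hrt : r ≤ t) :
    |(klTwoLegPieceG L M β U μ K (n + 1)).eval (t • dir θ) - (klLocalPart L M β U μ K (n + 1) θ - klLocalPart L M β U μ K n θ)| ≤
      ΛP * (2 * π / L) + (Λ₁ + Λ₀) * π * (2 * (π / L) / r) :=
  abs_eval_smul_dir_sub_profile_le_of_gridRead L (klTwoLegPieceG L M β U μ K (n + 1))
    (g := fun θ => klLocalPart L M β U μ K (n + 1) θ - klLocalPart L M β U μ K n θ)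
    (fun θ => by simp only [klLocalPart_periodic β U μ K (n + 1) θ, klLocalPart_periodic β U μ K n θ]) (add_nonneg hΛ₁ hΛ₀)
    (abs_sub_sub_sub_le_of_lipschitz hLip₁ hLip₀) hΛP hLipP
    (fun _ hk => eval_klTwoLegPieceG_succ_latticeMomentum_of_flat L M β U μ K n hk) hq hε hκ hL hr hrt

/-- **RAY FLATNESS of the piece `ℓ_{n+1}^G(K)`** (input (I2) of the wholesale continuation): for two ray points `t·dir θ`, `t′·dir θ` of the
half flat tube, `|ℓ_{n+1}^G(K)(t·dir θ) − ℓ_{n+1}^G(K)(t′·dir θ)| ≤ 2·(Λ_P·(2π/L) + (Λ₁ + Λ₀)·π·(2π/L)/r)` — every `K`, every `μ`. -/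
theorem abs_eval_klTwoLegPieceG_succ_sub_le_of_ray {β U μ : ℝ} {K : TrigPolyC4v} {n : ℕ} {Λ₁ Λ₀ : ℝ} (hΛ₁ : 0 ≤ Λ₁)
    (hΛ₀ : 0 ≤ Λ₀) (hLip₁ : ∀ a b, |klLocalPart L M β U μ K (n + 1) a - klLocalPart L M β U μ K (n + 1) b| ≤ Λ₁ * |a - b|)
    (hLip₀ : ∀ a b, |klLocalPart L M β U μ K n a - klLocalPart L M β U μ K n b| ≤ Λ₀ * |a - b|) {ΛP : ℝ} (hΛP : 0 ≤ ΛP)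
    (hLipP : ∀ p p' : Fin 2 → ℝ, |(klTwoLegPieceG L M β U μ K (n + 1)).eval p - (klTwoLegPieceG L M β U μ K (n + 1)).eval p'| ≤
      ΛP * (|p 0 - p' 0| + |p 1 - p' 1|))
    {t t' θ : ℝ} (hq : ∀ i, |(t • dir θ) i| ≤ π - 2 * π / L) (hq' : ∀ i, |(t' • dir θ) i| ≤ π - 2 * π / L) {κ κ' : ℝ}
    (hε : eps2 ((t • dir θ) 0) ((t • dir θ) 1) = μ + κ) (hκ : |κ| ≤ klFlatR / 2)
    (hε' : eps2 ((t' • dir θ) 0) ((t' • dir θ) 1) = μ + κ') (hκ' : |κ'| ≤ klFlatR / 2) (hL : 8 * π / klFlatR ≤ L) {r : ℝ}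
    (hr : 2 * π / L < r) (hrt : r ≤ t) (hrt' : r ≤ t') :
    |(klTwoLegPieceG L M β U μ K (n + 1)).eval (t • dir θ) - (klTwoLegPieceG L M β U μ K (n + 1)).eval (t' • dir θ)| ≤
      2 * (ΛP * (2 * π / L) + (Λ₁ + Λ₀) * π * (2 * (π / L) / r)) :=
  abs_eval_smul_dir_sub_eval_smul_dir_le_of_gridRead L (klTwoLegPieceG L M β U μ K (n + 1))
    (g := fun θ => klLocalPart L M β U μ K (n + 1) θ - klLocalPart L M β U μ K n θ)
    (fun θ => by simp only [klLocalPart_periodic β U μ K (n + 1) θ, klLocalPart_periodic β U μ K n θ]) (add_nonneg hΛ₁ hΛ₀)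
    (abs_sub_sub_sub_le_of_lipschitz hLip₁ hLip₀) hΛP hLipP
    (fun _ hk => eval_klTwoLegPieceG_succ_latticeMomentum_of_flat L M β U μ K n hk) hq hq' hε hκ hε' hκ' hL hr hrt hrt'

/-- **Wiggle of the scale-`0` piece `ℓ_0^G(K)` on a ray**: profile `ν_0(K) − K∘k_F` (`Λ₀`-, `Λ_F`-Lipschitz), piece `Λ_P`-Lipschitz:
`|ℓ_0^G(K)(t·dir θ) − (ν_0(K)(θ) − K(k_F θ))| ≤ Λ_P·(2π/L) + (Λ₀ + Λ_F)·π·(2π/L)/r`. -/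
theorem abs_eval_klTwoLegPieceG_zero_smul_dir_sub_le {β U μ : ℝ} {K : TrigPolyC4v} {Λ₀ ΛF : ℝ} (hΛ₀ : 0 ≤ Λ₀) (hΛF : 0 ≤ ΛF)
    (hLip₀ : ∀ a b, |klLocalPart L M β U μ K 0 a - klLocalPart L M β U μ K 0 b| ≤ Λ₀ * |a - b|)
    (hLipF : ∀ a b, |K.eval (klFermiPoint μ K a) - K.eval (klFermiPoint μ K b)| ≤ ΛF * |a - b|) {ΛP : ℝ} (hΛP : 0 ≤ ΛP)
    (hLipP : ∀ p p' : Fin 2 → ℝ, |(klTwoLegPieceG L M β U μ K 0).eval p - (klTwoLegPieceG L M β U μ K 0).eval p'| ≤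
      ΛP * (|p 0 - p' 0| + |p 1 - p' 1|))
    {t θ : ℝ} (hq : ∀ i, |(t • dir θ) i| ≤ π - 2 * π / L) {κ : ℝ} (hε : eps2 ((t • dir θ) 0) ((t • dir θ) 1) = μ + κ)
    (hκ : |κ| ≤ klFlatR / 2) (hL : 8 * π / klFlatR ≤ L) {r : ℝ} (hr : 2 * π / L < r) (hrt : r ≤ t) :
    |(klTwoLegPieceG L M β U μ K 0).eval (t • dir θ) - (klLocalPart L M β U μ K 0 θ - K.eval (klFermiPoint μ K θ))| ≤
      ΛP * (2 * π / L) + (Λ₀ + ΛF) * π * (2 * (π / L) / r) :=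
  abs_eval_smul_dir_sub_profile_le_of_gridRead L (klTwoLegPieceG L M β U μ K 0)
    (g := fun θ => klLocalPart L M β U μ K 0 θ - K.eval (klFermiPoint μ K θ))
    (fun θ => by simp only [klLocalPart_periodic β U μ K 0 θ, frameOnCurve_periodic μ K θ]) (add_nonneg hΛ₀ hΛF)
    (abs_sub_sub_sub_le_of_lipschitz hLip₀ hLipF) hΛP hLipP
    (fun _ hk => eval_klTwoLegPieceG_zero_latticeMomentum_of_flat L M β U μ K hk) hq hε hκ hL hr hrt

/-- **RAY FLATNESS of the scale-`0` piece `ℓ_0^G(K)`**: for two ray points of the half flat tube,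
`|ℓ_0^G(K)(t·dir θ) − ℓ_0^G(K)(t′·dir θ)| ≤ 2·(Λ_P·(2π/L) + (Λ₀ + Λ_F)·π·(2π/L)/r)` — every `K`, every `μ`. -/
theorem abs_eval_klTwoLegPieceG_zero_sub_le_of_ray {β U μ : ℝ} {K : TrigPolyC4v} {Λ₀ ΛF : ℝ} (hΛ₀ : 0 ≤ Λ₀) (hΛF : 0 ≤ ΛF)
    (hLip₀ : ∀ a b, |klLocalPart L M β U μ K 0 a - klLocalPart L M β U μ K 0 b| ≤ Λ₀ * |a - b|)
    (hLipF : ∀ a b, |K.eval (klFermiPoint μ K a) - K.eval (klFermiPoint μ K b)| ≤ ΛF * |a - b|) {ΛP : ℝ} (hΛP : 0 ≤ ΛP)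
    (hLipP : ∀ p p' : Fin 2 → ℝ, |(klTwoLegPieceG L M β U μ K 0).eval p - (klTwoLegPieceG L M β U μ K 0).eval p'| ≤
      ΛP * (|p 0 - p' 0| + |p 1 - p' 1|))
    {t t' θ : ℝ} (hq : ∀ i, |(t • dir θ) i| ≤ π - 2 * π / L) (hq' : ∀ i, |(t' • dir θ) i| ≤ π - 2 * π / L) {κ κ' : ℝ}
    (hε : eps2 ((t • dir θ) 0) ((t • dir θ) 1) = μ + κ) (hκ : |κ| ≤ klFlatR / 2)
    (hε' : eps2 ((t' • dir θ) 0) ((t' • dir θ) 1) = μ + κ') (hκ' : |κ'| ≤ klFlatR / 2) (hL : 8 * π / klFlatR ≤ L) {r : ℝ}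
    (hr : 2 * π / L < r) (hrt : r ≤ t) (hrt' : r ≤ t') :
    |(klTwoLegPieceG L M β U μ K 0).eval (t • dir θ) - (klTwoLegPieceG L M β U μ K 0).eval (t' • dir θ)| ≤
      2 * (ΛP * (2 * π / L) + (Λ₀ + ΛF) * π * (2 * (π / L) / r)) :=
  abs_eval_smul_dir_sub_eval_smul_dir_le_of_gridRead L (klTwoLegPieceG L M β U μ K 0)
    (g := fun θ => klLocalPart L M β U μ K 0 θ - K.eval (klFermiPoint μ K θ))
    (fun θ => by simp only [klLocalPart_periodic β U μ K 0 θ, frameOnCurve_periodic μ K θ]) (add_nonneg hΛ₀ hΛF)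
    (abs_sub_sub_sub_le_of_lipschitz hLip₀ hLipF) hΛP hLipP
    (fun _ hk => eval_klTwoLegPieceG_zero_latticeMomentum_of_flat L M β U μ K hk) hq hq' hε hκ hε' hκ' hL hr hrt hrt'

/-- **Wiggle of the extended local part `D_n^G(K)` on a ray**: `|D_n^G(K)(t·dir θ) − ν_n(K)(θ)| ≤ Λ_P·(2π/L) + Λ_ν·π·(2π/L)/r` for
`ν_n(K)` `Λ_ν`-Lipschitz in the angle and `D_n^G(K)` `Λ_P`-Lipschitz — every `K`, every `μ`. -/
theorem abs_eval_klTwoLegPolyG_smul_dir_sub_localPart_le {β U μ : ℝ} {K : TrigPolyC4v} {n : ℕ} {Λν : ℝ} (hΛν : 0 ≤ Λν)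
    (hLipν : ∀ a b, |klLocalPart L M β U μ K n a - klLocalPart L M β U μ K n b| ≤ Λν * |a - b|) {ΛP : ℝ} (hΛP : 0 ≤ ΛP)
    (hLipP : ∀ p p' : Fin 2 → ℝ, |(klTwoLegPolyG L M β U μ K n).eval p - (klTwoLegPolyG L M β U μ K n).eval p'| ≤
      ΛP * (|p 0 - p' 0| + |p 1 - p' 1|))
    {t θ : ℝ} (hq : ∀ i, |(t • dir θ) i| ≤ π - 2 * π / L) {κ : ℝ} (hε : eps2 ((t • dir θ) 0) ((t • dir θ) 1) = μ + κ)
    (hκ : |κ| ≤ klFlatR / 2) (hL : 8 * π / klFlatR ≤ L) {r : ℝ} (hr : 2 * π / L < r) (hrt : r ≤ t) :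
    |(klTwoLegPolyG L M β U μ K n).eval (t • dir θ) - klLocalPart L M β U μ K n θ| ≤
      ΛP * (2 * π / L) + Λν * π * (2 * (π / L) / r) :=
  abs_eval_smul_dir_sub_profile_le_of_gridRead L (klTwoLegPolyG L M β U μ K n) (klLocalPart_periodic β U μ K n) hΛν hLipν hΛP
    hLipP (fun _ hk => eval_klTwoLegPolyG_latticeMomentum_of_flat L M β U μ K n hk) hq hε hκ hL hr hrt

/-- **RAY FLATNESS of the extended local part `D_n^G(K)`**: `|D_n^G(K)(t·dir θ) − D_n^G(K)(t′·dir θ)| ≤ 2·(Λ_P·(2π/L) + Λ_ν·π·(2π/L)/r)`. -/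
theorem abs_eval_klTwoLegPolyG_sub_le_of_ray {β U μ : ℝ} {K : TrigPolyC4v} {n : ℕ} {Λν : ℝ} (hΛν : 0 ≤ Λν)
    (hLipν : ∀ a b, |klLocalPart L M β U μ K n a - klLocalPart L M β U μ K n b| ≤ Λν * |a - b|) {ΛP : ℝ} (hΛP : 0 ≤ ΛP)
    (hLipP : ∀ p p' : Fin 2 → ℝ, |(klTwoLegPolyG L M β U μ K n).eval p - (klTwoLegPolyG L M β U μ K n).eval p'| ≤
      ΛP * (|p 0 - p' 0| + |p 1 - p' 1|))
    {t t' θ : ℝ} (hq : ∀ i, |(t • dir θ) i| ≤ π - 2 * π / L) (hq' : ∀ i, |(t' • dir θ) i| ≤ π - 2 * π / L) {κ κ' : ℝ}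
    (hε : eps2 ((t • dir θ) 0) ((t • dir θ) 1) = μ + κ) (hκ : |κ| ≤ klFlatR / 2)
    (hε' : eps2 ((t' • dir θ) 0) ((t' • dir θ) 1) = μ + κ') (hκ' : |κ'| ≤ klFlatR / 2) (hL : 8 * π / klFlatR ≤ L) {r : ℝ}
    (hr : 2 * π / L < r) (hrt : r ≤ t) (hrt' : r ≤ t') :
    |(klTwoLegPolyG L M β U μ K n).eval (t • dir θ) - (klTwoLegPolyG L M β U μ K n).eval (t' • dir θ)| ≤
      2 * (ΛP * (2 * π / L) + Λν * π * (2 * (π / L) / r)) :=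
  abs_eval_smul_dir_sub_eval_smul_dir_le_of_gridRead L (klTwoLegPolyG L M β U μ K n) (klLocalPart_periodic β U μ K n) hΛν
    hLipν hΛP hLipP (fun _ hk => eval_klTwoLegPolyG_latticeMomentum_of_flat L M β U μ K n hk) hq hq' hε hκ hε' hκ' hL hr hrt hrt'

/-! ## §3 The slot instance: (E3a-G) order 1 + (E3g) order 1 ⇒ the piece's ray flatness with k3c3-p2's `rayBar`-type constant -/

/-- **RAY FLATNESS OF `ℓ_{n+1}^G(K)` FROM THE TWO-LEG SLOT**: under (E3a-G) `TwoLegSizesG … (n+1)` (tier 1, order `j = 1`: the piece is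
`twoLegBar G Q U 1 (n+1)`-Lipschitz, k3c3-p3's `abs_eval_klTwoLegPieceG_sub_le_of_sizes`) and (E3g) at the scales `n+1` and `n`
(`TwoLegAngularG.abs_sub_le`: `ν` is `angBar…1`-Lipschitz), for two ray points `t·dir θ`, `t′·dir θ` of the half flat tube:
`|ℓ_{n+1}^G(K)(t·dir θ) − ℓ_{n+1}^G(K)(t′·dir θ)| ≤ 2·(twoLegBar G Q U 1 (n+1)·(2π/L) + 2·angBar G Q R U (nScales β) 1·π·(2π/L)/r)`. -/
theorem abs_eval_klTwoLegPieceG_succ_sub_le_of_ray_of_slot {G : GeoConsts} {Q : EngConsts} {R : RenConsts} (hG : G.WF) (hQ : Q.WF)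
    (hR : R.WF) {β U μ : ℝ} {K : TrigPolyC4v} {n : ℕ} (hsz : TwoLegSizesG L M G Q R β U μ K (n + 1))
    (hang₁ : TwoLegAngularG L M G Q R β U μ K (n + 1)) (hang₀ : TwoLegAngularG L M G Q R β U μ K n)
    {t t' θ : ℝ} (hq : ∀ i, |(t • dir θ) i| ≤ π - 2 * π / L) (hq' : ∀ i, |(t' • dir θ) i| ≤ π - 2 * π / L) {κ κ' : ℝ}
    (hε : eps2 ((t • dir θ) 0) ((t • dir θ) 1) = μ + κ) (hκ : |κ| ≤ klFlatR / 2)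
    (hε' : eps2 ((t' • dir θ) 0) ((t' • dir θ) 1) = μ + κ') (hκ' : |κ'| ≤ klFlatR / 2) (hL : 8 * π / klFlatR ≤ L) {r : ℝ}
    (hr : 2 * π / L < r) (hrt : r ≤ t) (hrt' : r ≤ t') :
    |(klTwoLegPieceG L M β U μ K (n + 1)).eval (t • dir θ) - (klTwoLegPieceG L M β U μ K (n + 1)).eval (t' • dir θ)| ≤
      2 * (twoLegBar G Q U 1 (n + 1) * (2 * π / L) +
        (angBar G Q R U (nScales β) 1 + angBar G Q R U (nScales β) 1) * π * (2 * (π / L) / r)) := by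
  have hΛ : 0 ≤ angBar G Q R U (nScales β) 1 := angBar_nonneg hG hQ hR U _ 1
  have hB : 0 ≤ twoLegBar G Q U 1 (n + 1) := by
    have h := hsz.1 1 (by norm_num) (WithLp.toLp 2 (0 : Fin 2 → ℝ))
    exact (norm_nonneg _).trans h
  exact abs_eval_klTwoLegPieceG_succ_sub_le_of_ray L M hΛ hΛ hang₁.abs_sub_le hang₀.abs_sub_le hB
    (abs_eval_klTwoLegPieceG_sub_le_of_sizes hsz) hq hq' hε hκ hε' hκ' hL hr hrt hrt'

end Model

end Summit.HubbardSuperconductivity.HubbardSuperconductivity.Theorems.KLRegimeSplit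

end
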